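import Literature.AlgebraicGeometry.Motives.UniversalHypersurfaceFamily
import Literature.NumberTheory.Transcendental.NesterenkoGenericPoints
import Mathlib.RingTheory.Nullstellensatz
import Mathlib.RingTheory.MvPolynomial.EulerIdentity
import Mathlib.Topology.MetricSpace.ProperSpace
import HarnessLib

/-!
# General nonsingular forms exist: a nonsingular form of degree `d ≥ 1` outside any countable
# union of proper algebraic subsets of the space of forms (Baire)

Family `hodge`, layer `Literature/AlgebraicGeometry/Motives`; companion (theorems only) of
`Motives/UniversalHypersurfaceFamily`, whose base `Spec k[a_m]` is the parameter space of forms of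
degree `d` on `ℙⁿ⁺¹` with universal form `F = Σ a_m x^m`. Statements about a "general" or "very
general" hypersurface (Soulé–Voisin 2005, §2: "'general' means that the defining equation for `X`
has to be chosen away from a specified union of countably many Zariski closed proper subsets of the
parameter space"; Voisin, *Hodge Theory II*, §6.2.1) are consumed through the existence of such an
equation which is moreover NONSINGULAR. Over `ℂ` this is Baire's theorem in the coefficient space
`ℂ^{DegIndex n d}`, and this file proves it:

* `SmoothHypersurface.IsNonsingularForm.exists_eval_pderiv_ne_zero` /
  `SmoothHypersurface.isNonsingularForm_of_forall_exists_eval_pderiv_ne_zero` — over an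
  algebraically closed field the ideal-theoretic nonsingularity of `Motives/HypersurfaceFormsNonsingular`
  (every prime containing `F` and all `∂ⱼF` contains all variables) is the pointwise Jacobian
  criterion "`F` and its partials have no common zero `z ≠ 0`" (Hilbert's Nullstellensatz, Mathlib
  `MvPolynomial.vanishingIdeal_zeroLocus_eq_radical`; Hartshorne I Ex. 5.8);
* `UniversalHypersurface.specialize` lemmas — the form `F_c = Σ c_m x^m` of a coefficient vector `c`
  (`MvPolynomial.map (eval c) (universalForm ℂ n d)`): homogeneous of degree `d`, with coefficient
  vector `c`, every form of degree `d` being an `F_c`, and `(c, z) ↦ F_c(z)`, `(c, z) ↦ ∂ⱼF_c(z)`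
  continuous;
* `UniversalHypersurface.isClosed_setOf_exists_common_zero` — the set of `c` such that `F_c` and its
  partials have a common zero `z ≠ 0` is closed (scale `z` to the unit sphere, which is compact, and
  project), so the pointwise-nonsingular `c` form an OPEN set, non-empty for `d ≥ 1` (Fermat);
* `UniversalHypersurface.interior_eq_empty_of_algebraic` — a proper algebraic subset
  `{c | ∀ P ∈ S, P(c) = 0} ≠ ℂ^N` is closed with empty interior (a polynomial vanishing on a
  non-empty open set is zero, `Nesterenko.eq_zero_of_eval_eq_zero_of_isOpen`);
* **`UniversalHypersurface.exists_isNonsingularForm_notMem_sUnion`** — for `d ≥ 1` and a countable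
  family `𝓑` of proper algebraic subsets of `ℂ^{DegIndex n d}` there is a nonsingular form `G` of
  degree `d` whose coefficient vector lies outside `⋃ 𝓑` (Baire: `ℂ^N` is complete, Mathlib
  `dense_biInter_of_isOpen`).

Everything is proved; no definitions, no named facts.

## References

* [SouleVoisin2005] C. Soulé, C. Voisin, Adv. Math. 198 (2005), §2 (definition of "general").
* [VoisinHodgeII2003] C. Voisin, Hodge Theory and Complex Algebraic Geometry II, §6.2.1.
* [Hartshorne1977] R. Hartshorne, Algebraic Geometry, I Ex. 5.8 (projective Jacobian criterion),
  I Thm. 1.3A (Nullstellensatz).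
-/

noncomputable section

open MvPolynomial Set Topology

namespace Literature.AlgebraicGeometry.Motives

/-! ### Nonsingularity: ideal-theoretic versus pointwise -/

namespace SmoothHypersurface

variable {k : Type*} [Field k] {n : ℕ}

/-- **Easy half of the Jacobian criterion**: a nonsingular form and its partials have no common zero
`z ≠ 0` (the kernel of evaluation at `z` is a prime containing `F` and the `∂ⱼF`, hence every `xᵢ`,
so `zᵢ = 0`). [cite: Hartshorne1977, I Ex. 5.8] -/
theorem IsNonsingularForm.exists_eval_pderiv_ne_zero {F : MvPolynomial (Fin (n + 2)) k}
    (hF : IsNonsingularForm k F) {z : Fin (n + 2) → k} (hz : z ≠ 0) (hFz : eval z F = 0) :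
    ∃ j, eval z (pderiv j F) ≠ 0 := by
  by_contra h
  push Not at h
  apply hz
  funext i
  have hX := hF (RingHom.ker (eval z)) (RingHom.ker_isPrime _) (by simpa using hFz)
    (fun j => by simpa using h j) i
  simpa using hX

/-- **Hilbert's Nullstellensatz half of the Jacobian criterion**: over an algebraically closed
field, if `F` and its partials `∂ⱼF` have no common zero `z ≠ 0`, then `F` is a nonsingular form
(every `xᵢ` vanishes on the common zero set `⊆ {0}` of the ideal `(F, ∂ⱼF)`, hence lies in its
radical, hence in every prime containing it). [cite: Hartshorne1977, I Ex. 5.8 and I Thm. 1.3A] -/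
theorem isNonsingularForm_of_forall_exists_eval_pderiv_ne_zero [IsAlgClosed k]
    {F : MvPolynomial (Fin (n + 2)) k}
    (h : ∀ z : Fin (n + 2) → k, z ≠ 0 → eval z F = 0 → ∃ j, eval z (pderiv j F) ≠ 0) :
    IsNonsingularForm k F := by
  intro 𝔭 h𝔭 hF𝔭 hder i
  let I : Ideal (MvPolynomial (Fin (n + 2)) k) :=
    Ideal.span (insert F (Set.range fun j => pderiv j F))
  have hI𝔭 : I ≤ 𝔭 := by
    rw [Ideal.span_le]
    rintro q (rfl | ⟨j, rfl⟩)
    exacts [hF𝔭, hder j]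
  have hXrad : (X i : MvPolynomial (Fin (n + 2)) k) ∈ I.radical := by
    rw [← vanishingIdeal_zeroLocus_eq_radical (K := k), mem_vanishingIdeal_iff]
    intro z hz
    rw [zeroLocus_span] at hz
    have hz0 : z = 0 := by
      by_contra hne
      obtain ⟨j, hj⟩ := h z hne (by simpa using hz F (Set.mem_insert _ _))
      exact hj (by simpa using hz _ (Set.mem_insert_of_mem _ ⟨j, rfl⟩))
    simp [hz0]
  exact h𝔭.radical ▸ Ideal.radical_mono hI𝔭 hXrad

/-- Over an algebraically closed field, `F` is a nonsingular form iff `F` and its partials have no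
common zero `z ≠ 0`. [cite: Hartshorne1977, I Ex. 5.8] -/
theorem isNonsingularForm_iff_forall_exists_eval_pderiv_ne_zero [IsAlgClosed k]
    {F : MvPolynomial (Fin (n + 2)) k} :
    IsNonsingularForm k F ↔
      ∀ z : Fin (n + 2) → k, z ≠ 0 → eval z F = 0 → ∃ j, eval z (pderiv j F) ≠ 0 :=
  ⟨fun hF _ hz hFz => hF.exists_eval_pderiv_ne_zero hz hFz,
    isNonsingularForm_of_forall_exists_eval_pderiv_ne_zero⟩

end SmoothHypersurface

/-! ### The form of a coefficient vector -/

namespace UniversalHypersurface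

open SmoothHypersurface

variable (n d : ℕ)

/-- The specialisation `F_c` of the universal form at a coefficient vector `c` is `Σ_m c_m x^m`.
[folklore] -/
theorem map_eval_universalForm (c : DegIndex n d → ℂ) :
    MvPolynomial.map (eval c) (universalForm ℂ n d) = ∑ m : DegIndex n d, monomial m.1 (c m) := by
  simp [universalForm, map_monomial]

/-- `F_c = Σ_m c_m • x^m` with constant coefficients pulled out. [folklore] -/
theorem map_eval_universalForm_eq_sum_C_mul (c : DegIndex n d → ℂ) :
    MvPolynomial.map (eval c) (universalForm ℂ n d) =
      ∑ m : DegIndex n d, C (c m) * monomial m.1 1 := by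
  rw [map_eval_universalForm]
  refine Finset.sum_congr rfl fun m _ => ?_
  rw [C_mul_monomial, mul_one]

/-- `F_c` is homogeneous of degree `d`. [folklore] -/
theorem isHomogeneous_map_eval_universalForm (c : DegIndex n d → ℂ) :
    (MvPolynomial.map (eval c) (universalForm ℂ n d)).IsHomogeneous d :=
  (isHomogeneous_universalForm ℂ n d).map _

/-- The coefficient vector of `F_c` is `c`. [folklore] -/
theorem coeff_map_eval_universalForm (c : DegIndex n d → ℂ) (m : DegIndex n d) :
    coeff m.1 (MvPolynomial.map (eval c) (universalForm ℂ n d)) = c m := by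
  classical
  rw [map_eval_universalForm, coeff_sum]
  simp only [coeff_monomial]
  rw [Finset.sum_eq_single m (fun b _ hb => if_neg fun h => hb (Subtype.ext h))
    (fun h => absurd (Finset.mem_univ _) h), if_pos rfl]

/-- The coefficient vector of `F_c`, as a function, is `c`. [folklore] -/
theorem coeffVec_map_eval_universalForm (c : DegIndex n d → ℂ) :
    (fun m : DegIndex n d => coeff m.1 (MvPolynomial.map (eval c) (universalForm ℂ n d))) = c :=
  funext (coeff_map_eval_universalForm n d c)

/-- Every form of degree `d` is the specialisation of the universal form at its coefficient vector.
[folklore] -/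
theorem map_eval_coeff_universalForm (G : MvPolynomial (Fin (n + 2)) ℂ) (hG : G.IsHomogeneous d) :
    MvPolynomial.map (eval fun m : DegIndex n d => coeff m.1 G) (universalForm ℂ n d) = G := by
  rw [map_eval_universalForm]
  exact sum_monomial_coeff_eq n d G hG

/-- `(c, z) ↦ Q_c(z)` is continuous for `Q_c = Σ_m c_m · Q_m` with fixed polynomials `Q_m`.
[folklore] -/
theorem continuous_eval_sum_C_mul (Q : DegIndex n d → MvPolynomial (Fin (n + 2)) ℂ) :
    Continuous fun q : (DegIndex n d → ℂ) × (Fin (n + 2) → ℂ) =>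
      eval q.2 (∑ m : DegIndex n d, C (q.1 m) * Q m) := by
  simp only [map_sum, map_mul, eval_C]
  refine continuous_finsetSum _ fun m _ => ?_
  exact ((continuous_apply m).comp continuous_fst).mul
    ((MvPolynomial.continuous_eval (Q m)).comp continuous_snd)

/-- `(c, z) ↦ F_c(z)` is continuous. [folklore] -/
theorem continuous_eval_map_eval_universalForm :
    Continuous fun q : (DegIndex n d → ℂ) × (Fin (n + 2) → ℂ) =>
      eval q.2 (MvPolynomial.map (eval q.1) (universalForm ℂ n d)) := by
  simp only [map_eval_universalForm_eq_sum_C_mul]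
  exact continuous_eval_sum_C_mul n d fun m => monomial m.1 1

/-- `∂ⱼ F_c = Σ_m c_m ∂ⱼ(x^m)`. [folklore] -/
theorem pderiv_map_eval_universalForm (c : DegIndex n d → ℂ) (j : Fin (n + 2)) :
    pderiv j (MvPolynomial.map (eval c) (universalForm ℂ n d)) =
      ∑ m : DegIndex n d, C (c m) * pderiv j (monomial m.1 1) := by
  rw [map_eval_universalForm_eq_sum_C_mul, map_sum]
  exact Finset.sum_congr rfl fun m _ => pderiv_C_mul

/-- `(c, z) ↦ ∂ⱼF_c(z)` is continuous. [folklore] -/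
theorem continuous_eval_pderiv_map_eval_universalForm (j : Fin (n + 2)) :
    Continuous fun q : (DegIndex n d → ℂ) × (Fin (n + 2) → ℂ) =>
      eval q.2 (pderiv j (MvPolynomial.map (eval q.1) (universalForm ℂ n d))) := by
  simp only [pderiv_map_eval_universalForm]
  exact continuous_eval_sum_C_mul n d fun m => pderiv j (monomial m.1 1)

/-! ### The pointwise-nonsingular coefficient vectors form a non-empty open set -/

/-- Scaling a common zero: for a form `φ` of degree `e`, `φ(t • z) = t ^ e · φ(z)`. [folklore] -/
theorem eval_smul_of_isHomogeneous {φ : MvPolynomial (Fin (n + 2)) ℂ} {e : ℕ}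
    (hφ : φ.IsHomogeneous e) (t : ℂ) (z : Fin (n + 2) → ℂ) :
    eval (t • z) φ = t ^ e * eval z φ := by
  classical
  conv_lhs => rw [← φ.support_sum_monomial_coeff]
  conv_rhs => rw [← φ.support_sum_monomial_coeff]
  rw [map_sum, map_sum, Finset.mul_sum]
  refine Finset.sum_congr rfl fun m hm => ?_
  have hdeg : (m.sum fun _ k => k) = e := by
    have := hφ (mem_support_iff.1 hm)
    simpa only [Finsupp.weight_apply, Pi.one_apply, smul_eq_mul, mul_one] using this
  rw [eval_monomial, eval_monomial, Finsupp.prod, Finsupp.prod]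
  simp only [Pi.smul_apply, smul_eq_mul, mul_pow, Finset.prod_mul_distrib,
    Finset.prod_pow_eq_pow_sum]
  rw [show (∑ i ∈ m.support, m i) = e from hdeg]
  ring

/-- **Projection along the sphere.** For a closed condition `P` on `E × V` (`V` a proper normed
space over `ℂ`) stable under positive real rescaling of the second variable, the set of `c` such
that `P c z` holds for some `z ≠ 0` is closed: it is the projection to `E` of the closed subset
`{P}` of `E × S`, `S` the (compact) unit sphere of `V`. [folklore] -/
theorem isClosed_setOf_exists_ne_zero {E V : Type*} [TopologicalSpace E] [NormedAddCommGroup V]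
    [NormedSpace ℂ V] [ProperSpace V] (P : E → V → Prop)
    (hP : IsClosed {q : E × V | P q.1 q.2})
    (hscale : ∀ c z (t : ℝ), 0 < t → P c z → P c ((t : ℂ) • z)) :
    IsClosed {c : E | ∃ z : V, z ≠ 0 ∧ P c z} := by
  let S := Metric.sphere (0 : V) 1
  have hι : Continuous fun q : E × S => (q.1, (q.2 : V)) :=
    continuous_fst.prodMk (continuous_subtype_val.comp continuous_snd)
  have hK : IsClosed ((fun q : E × S => (q.1, (q.2 : V))) ⁻¹' {q : E × V | P q.1 q.2}) :=
    hP.preimage hι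
  have himage : Prod.fst '' ((fun q : E × S => (q.1, (q.2 : V))) ⁻¹' {q : E × V | P q.1 q.2}) =
      {c : E | ∃ z : V, z ≠ 0 ∧ P c z} := by
    ext c
    constructor
    · rintro ⟨⟨c', s⟩, hq, rfl⟩
      refine ⟨(s : V), fun h0 => ?_, hq⟩
      have hs1 : ‖(s : V)‖ = 1 := by simp [S]
      rw [h0, norm_zero] at hs1
      exact zero_ne_one hs1
    · rintro ⟨z, hz, hPz⟩
      have hzn : 0 < ‖z‖ := norm_pos_iff.mpr hz
      have hts : ((‖z‖⁻¹ : ℝ) : ℂ) • z ∈ S := by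
        rw [mem_sphere_iff_norm, sub_zero, norm_smul, Complex.norm_real, norm_inv, norm_norm]
        exact inv_mul_cancel₀ hzn.ne'
      exact ⟨(c, ⟨_, hts⟩), hscale c z _ (inv_pos.mpr hzn) hPz, rfl⟩
  rw [← himage]
  exact isClosedMap_fst_of_compactSpace _ hK

/-- **The locus of coefficient vectors whose form has a singular point is closed**: the set of `c`
such that `F_c` and all `∂ⱼF_c` have a common zero `z ≠ 0` is the projection of a closed subset of
`ℂ^N × S` along the (compact) unit sphere `S` of `ℂⁿ⁺²` — a common zero may be scaled to the sphere
by homogeneity. [cite: Hartshorne1977, I Ex. 5.8] -/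
theorem isClosed_setOf_exists_common_zero :
    IsClosed {c : DegIndex n d → ℂ | ∃ z : Fin (n + 2) → ℂ, z ≠ 0 ∧
      (eval z (MvPolynomial.map (eval c) (universalForm ℂ n d)) = 0 ∧
        ∀ j, eval z (pderiv j (MvPolynomial.map (eval c) (universalForm ℂ n d))) = 0)} := by
  refine isClosed_setOf_exists_ne_zero
    (fun (c : DegIndex n d → ℂ) (z : Fin (n + 2) → ℂ) =>
      eval z (MvPolynomial.map (eval c) (universalForm ℂ n d)) = 0 ∧
        ∀ j, eval z (pderiv j (MvPolynomial.map (eval c) (universalForm ℂ n d))) = 0) ?_ ?_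
  · have e : {q : (DegIndex n d → ℂ) × (Fin (n + 2) → ℂ) |
        eval q.2 (MvPolynomial.map (eval q.1) (universalForm ℂ n d)) = 0 ∧
          ∀ j, eval q.2 (pderiv j (MvPolynomial.map (eval q.1) (universalForm ℂ n d))) = 0} =
        (fun q => eval q.2 (MvPolynomial.map (eval q.1) (universalForm ℂ n d))) ⁻¹' {0} ∩
          ⋂ j, (fun q => eval q.2 (pderiv j (MvPolynomial.map (eval q.1) (universalForm ℂ n d))))
            ⁻¹' {0} := by
      ext q
      simp only [Set.mem_setOf_eq, Set.mem_inter_iff, Set.mem_preimage, Set.mem_singleton_iff,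
        Set.mem_iInter]
    rw [e]
    exact (isClosed_singleton.preimage (continuous_eval_map_eval_universalForm n d)).inter
      (isClosed_iInter fun j =>
        isClosed_singleton.preimage (continuous_eval_pderiv_map_eval_universalForm n d j))
  · rintro c z t - ⟨hzF, hzd⟩
    refine ⟨?_, fun j => ?_⟩
    · rw [eval_smul_of_isHomogeneous n (isHomogeneous_map_eval_universalForm n d c), hzF, mul_zero]
    · rw [eval_smul_of_isHomogeneous n ((isHomogeneous_map_eval_universalForm n d c).pderiv),
        hzd j, mul_zero]

/-- Hence **the pointwise-nonsingular coefficient vectors form an open set**. [cite: Hartshorne1977, I Ex. 5.8] -/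
theorem isOpen_setOf_forall_exists_eval_pderiv_ne_zero :
    IsOpen {c : DegIndex n d → ℂ | ∀ z : Fin (n + 2) → ℂ, z ≠ 0 →
      eval z (MvPolynomial.map (eval c) (universalForm ℂ n d)) = 0 →
        ∃ j, eval z (pderiv j (MvPolynomial.map (eval c) (universalForm ℂ n d))) ≠ 0} := by
  have h := (isClosed_setOf_exists_common_zero n d).isOpen_compl
  convert h using 1
  ext c
  simp only [Set.mem_setOf_eq, Set.mem_compl_iff, not_exists, not_and, not_forall]

/-- The Fermat vector: the pointwise-nonsingular set is non-empty for `d ≥ 1` (the Fermat form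
`Σ xᵢᵈ` is nonsingular, `Motives/HypersurfaceFormsNonsingular`). [cite: Hartshorne1977, I Ex. 5.5] -/
theorem setOf_forall_exists_eval_pderiv_ne_zero_nonempty (hd : 0 < d) :
    {c : DegIndex n d → ℂ | ∀ z : Fin (n + 2) → ℂ, z ≠ 0 →
      eval z (MvPolynomial.map (eval c) (universalForm ℂ n d)) = 0 →
        ∃ j, eval z (pderiv j (MvPolynomial.map (eval c) (universalForm ℂ n d))) ≠ 0}.Nonempty := by
  let G : MvPolynomial (Fin (n + 2)) ℂ := ∑ i : Fin (n + 2), X i ^ d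
  have hG : G.IsHomogeneous d := IsHomogeneous.sum _ _ _ fun i _ => isHomogeneous_X_pow i d
  have hJ : IsNonsingularForm ℂ G :=
    isNonsingularForm_sum_X_pow (by exact_mod_cast hd.ne')
  refine ⟨fun m => coeff m.1 G, ?_⟩
  simp only [Set.mem_setOf_eq, map_eval_coeff_universalForm n d G hG]
  exact fun z hz hGz => hJ.exists_eval_pderiv_ne_zero hz hGz

/-! ### Proper algebraic subsets are nowhere dense; Baire -/

/-- **A proper algebraic subset of `ℂ^N` is closed with empty interior**: if
`T = {c | ∀ P ∈ S, P(c) = 0} ≠ ℂ^N`, some `P ∈ S` does not vanish at some point; a polynomial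
vanishing on a non-empty open set is zero (`Nesterenko.eq_zero_of_eval_eq_zero_of_isOpen`).
[folklore] -/
theorem isClosed_and_interior_eq_empty_of_algebraic {ι : Type*} [Fintype ι]
    {T : Set (ι → ℂ)} (S : Set (MvPolynomial ι ℂ)) (hT : T = {c | ∀ P ∈ S, eval c P = 0})
    (hTu : T ≠ Set.univ) : IsClosed T ∧ interior T = ∅ := by
  subst hT
  refine ⟨?_, ?_⟩
  · have : {c : ι → ℂ | ∀ P ∈ S, eval c P = 0} = ⋂ P ∈ S, {c | eval c P = 0} := by
      ext c; simp
    rw [this]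
    exact isClosed_biInter fun P _ => isClosed_eq (MvPolynomial.continuous_eval P) continuous_const
  · by_contra hne
    obtain ⟨c₀, hc₀⟩ := (Set.ne_univ_iff_exists_notMem _).1 hTu
    simp only [Set.mem_setOf_eq, not_forall] at hc₀
    obtain ⟨P, hPS, hP⟩ := hc₀
    have hP0 : P = 0 :=
      Literature.NumberTheory.Transcendental.Nesterenko.eq_zero_of_eval_eq_zero_of_isOpen P
        isOpen_interior (Set.nonempty_iff_ne_empty.2 hne)
        fun z hz => (interior_subset hz : z ∈ {c : ι → ℂ | ∀ P ∈ S, eval c P = 0}) P hPS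
    exact hP (by rw [hP0, map_zero])

/-- **Baire**: the complement of a countable union of proper algebraic subsets of `ℂ^N` is dense.
[folklore] -/
theorem dense_compl_sUnion_of_algebraic {ι : Type*} [Fintype ι] (𝓑 : Set (Set (ι → ℂ)))
    (h𝓑c : 𝓑.Countable)
    (h𝓑 : ∀ T ∈ 𝓑, (∃ S : Set (MvPolynomial ι ℂ), T = {c | ∀ P ∈ S, eval c P = 0}) ∧
      T ≠ Set.univ) :
    Dense (⋃₀ 𝓑)ᶜ := by
  have hTc : ∀ T ∈ 𝓑, IsOpen Tᶜ ∧ Dense Tᶜ := fun T hT => by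
    obtain ⟨⟨S, hS⟩, hTu⟩ := h𝓑 T hT
    obtain ⟨hcl, hint⟩ := isClosed_and_interior_eq_empty_of_algebraic S hS hTu
    exact ⟨hcl.isOpen_compl, interior_eq_empty_iff_dense_compl.1 hint⟩
  have h := dense_biInter_of_isOpen (f := fun T : Set (ι → ℂ) => Tᶜ) (fun T hT => (hTc T hT).1) h𝓑c
    fun T hT => (hTc T hT).2
  rw [Set.compl_sUnion, Set.sInter_image]
  exact h

/-- **General nonsingular forms exist.** For `d ≥ 1` and a countable family `𝓑` of proper
algebraic subsets of the coefficient space `ℂ^{DegIndex n d}` of forms of degree `d` on `ℙⁿ⁺¹_ℂ`,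
there is a coefficient vector `c ∉ ⋃ 𝓑` whose form `F_c` is nonsingular: the pointwise-nonsingular
vectors form a non-empty open set, which meets the dense complement of `⋃ 𝓑`.
[cite: SouleVoisin2005, §2 (definition of "general")] [cite: Hartshorne1977, I Ex. 5.8] -/
theorem exists_notMem_sUnion_isNonsingularForm (hd : 0 < d) (𝓑 : Set (Set (DegIndex n d → ℂ)))
    (h𝓑c : 𝓑.Countable)
    (h𝓑 : ∀ T ∈ 𝓑, (∃ S : Set (CoeffRing ℂ n d), T = {c | ∀ P ∈ S, eval c P = 0}) ∧
      T ≠ Set.univ) :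
    ∃ c : DegIndex n d → ℂ, c ∉ ⋃₀ 𝓑 ∧
      IsNonsingularForm ℂ (MvPolynomial.map (eval c) (universalForm ℂ n d)) := by
  obtain ⟨c, hc⟩ := (dense_compl_sUnion_of_algebraic 𝓑 h𝓑c h𝓑).inter_open_nonempty _
    (isOpen_setOf_forall_exists_eval_pderiv_ne_zero n d)
    (setOf_forall_exists_eval_pderiv_ne_zero_nonempty n d hd)
  exact ⟨c, hc.2, isNonsingularForm_of_forall_exists_eval_pderiv_ne_zero hc.1⟩

/-- **General nonsingular forms exist** (form version): for `d ≥ 1` and a countable family `𝓑` of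
proper algebraic subsets of the coefficient space, there is a NONSINGULAR form `G` of degree `d` on
`ℙⁿ⁺¹_ℂ` whose coefficient vector lies outside `⋃ 𝓑`.
[cite: SouleVoisin2005, §2 (definition of "general")] [cite: Hartshorne1977, I Ex. 5.8] -/
theorem exists_isNonsingularForm_coeff_notMem_sUnion (hd : 0 < d)
    (𝓑 : Set (Set (DegIndex n d → ℂ))) (h𝓑c : 𝓑.Countable)
    (h𝓑 : ∀ T ∈ 𝓑, (∃ S : Set (CoeffRing ℂ n d), T = {c | ∀ P ∈ S, eval c P = 0}) ∧
      T ≠ Set.univ) :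
    ∃ G : MvPolynomial (Fin (n + 2)) ℂ, G.IsHomogeneous d ∧ IsNonsingularForm ℂ G ∧
      (fun m : DegIndex n d => coeff m.1 G) ∉ ⋃₀ 𝓑 := by
  obtain ⟨c, hc𝓑, hJ⟩ := exists_notMem_sUnion_isNonsingularForm n d hd 𝓑 h𝓑c h𝓑
  exact ⟨_, isHomogeneous_map_eval_universalForm n d c, hJ, by
    rwa [coeffVec_map_eval_universalForm]⟩

end UniversalHypersurface

end Literature.AlgebraicGeometry.Motives

end
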